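import Summits.AtomisticToContinuum.BoseEinsteinCondensation.Theorems.BECStronglyRayleighLatticeToPeriodicBridgeMuffinTinDeepWallsDepleteOfFloor
import Summits.AtomisticToContinuum.BoseEinsteinCondensation.Theorems.BECStronglyRayleighLatticeToPeriodicBridgeMuffinTinWellPacking
import Summits.AtomisticToContinuum.BoseEinsteinCondensation.Theorems.BECStronglyRayleighLatticeToPeriodicBridgeFewBodyCondensation

/-!
# Route `BECStronglyRayleigh`, crux `LatticeToPeriodicBridge` (stmt-AtomisticToContinuum-9674),
# line `muffin-tin-reward-supermodularity` — the DOWN half of the sandwich for stub S1a `stub_deepWallGerm`: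
# an upper-condensate floor above the well-volume share implies the registered sign

Helper file of the crux line `muffin-tin-reward-supermodularity` (lead prover-line-stmt-AtomisticToContinuum-9674-c2-0,
`--supports stmt-AtomisticToContinuum-9674`), assembling `…MuffinTinConfinementBound`, `…MuffinTinDeepWallsDepleteOfFloor`
and `…MuffinTinWellPacking`.

**The registered open stub.** `stub_deepWallGerm : Sig.stub_deepWallGerm := DeepWallGerm` (Defs module): for every
admissible `v` and `w ∈ (0,1)` there are `b₁, ρ₁ > 0` such that for `M ≥ 2`, `L ≥ b₁M`, `N ≤ ρ₁L³`, EVENTUALLY in the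
wall height `λ`, the `κ = 0⁺` germ of supermodularity of the two-coupling energy `E(λ,κ)` on `{0,λ}×[0,κ₀]` holds with
`o(κ)` slack; equivalently (`stub_maxwellDanskin` + `DownSandwich.germ_of_upperCondensate_le`) `n₀⁺(λ,0) ≤ n₀⁺(0,0)`
eventually in `λ` — "a deep enough thick muffin tin only depletes the largest ground-state constant-mode occupation".

**This file (DOWN).** `deepWallGerm_of_upperCondensateWellFloor`: the stub FOLLOWS from a floor on the WALL-FREE upper
condensate above the well-volume share,

  `UpperCondensateWellFloor :≡ ∀ v admissible ∀ w ∈ (0,1) ∃ b₁ ρ₁ > 0 ∀ M ≥ 2 ∀ L ≥ b₁M ∀ 1 ≤ N ≤ ρ₁L³,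
     ofReal((1-w)³N) < n₀⁺_{v,N,L}(0,0)`

(written out as the hypothesis; `n₀⁺(0,0) = upperCondensate v N L M w 0 0` does not depend on `M, w`). Proof: shrink
`b₁, ρ₁` so that the typed geometry is also dilute enough for `downSandwich_wellPacking` (a finite-energy state `Φ` living
in the wells: `E(λ,0) ≤ E_v[Φ]` for all `λ`); then `λ⟨W⟩_Ψ ≤ E_v[Φ] + 1` for `1`-near-minimisers and the confinement
bound `n₀(Ψ) ≤ (1+η)(1-w)³N + (1+η⁻¹)N⟨W⟩_Ψ` give `n₀⁺(λ,0) ≤ ((1-w)³ + ε)N ≤ n₀⁺(0,0)` eventually in `λ`, and reverse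
Danskin turns the occupation inequality into the energy germ (`downSandwich_deepWallGermAt`); `N = 0` is trivial.
`DownSandwich.deepWallGerm_fewBody` certifies S1a in the FEW-BODY corner (`2 ≤ N ≤ N₀`, `L ≥ B·M`, any `M ≥ 1`, any `w`
with `(1-w)³ < 2/3`) from `CoarseCellLorentzian.FewBody.fewBody_condensed` (few bosons on a large torus are `2/3`-condensed):
the open content of S1a is entirely the thermodynamic regime.

**Reading (the lead's census for the planners).** Together with the UP direction — the kernel-checked composition
`LatticeToPeriodicBridge_of : Sig.stub_deepWallGerm → Sig.stub_deepWellCondensateLimit → PeriodicRigidity → crux`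
(skeleton v4, `Lines/muffin_tin_reward_supermodularity.lean`), which consumes `KineticLatticeBEC` at `(M_N, N)` and
outputs the consequent with constant `z_{1/2}·c_A/8` — the registered sign S1a is SANDWICHED between two torus-BEC floors
of the wall-free dilute gas along the composition's sequence `(N, L_N = (N/ρ)^{1/3}, M_N ≍ L_N/B)`:

  `upper-condensate fraction > (1-w)³ = 1/8 (at w = ½), uniformly in N`  ⟹  S1a  ⟹ (with A, S2′, 9467)
  `every near-minimiser has condensate fraction ≥ z_{1/2} c_A / 8`.

So S1a is implied by a UNIFORM (in `N`, at fixed small density) condensation statement of the consequent's strength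
(upper-occupation form: SOME asymptotic ground state is `> 1/8`-condensed) and cannot be refuted short of refuting that;
conversely no tool in print proves it without proving condensation of that strength. The only place the antecedent
enters is the lattice value that the deep end must exceed. This is the muffin-tin analogue of the coarse-cell line's
certified dictionary (`…RowFlatnessSandwich`, `…PairFromSingle`, `…PlainCondensateFloor`).

References: LSSY2005 App. A (A.11); Fournais2020 (1.1)–(1.5); Ruelle 1969 §3.5.11; Danskin 1967 / Topkis 1978 (language).
-/

noncomputable section

namespace Summit.AtomisticToContinuum.BoseEinsteinCondensation.Cruxes.LatticeToPeriodicBridge.MuffinTinRewardSupermodularity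

open MeasureTheory Filter
open scoped ENNReal NNReal Topology
open Literature.MathematicalPhysics.QuantumManyBody.BoseGas
open Summit.AtomisticToContinuum.BoseEinsteinCondensation.Theses
open Summit.AtomisticToContinuum.BoseEinsteinCondensation.Theses.BECStronglyRayleigh
open Literature.MathematicalPhysics.QuantumLattice
open Literature.Probability.LatticeModels (TorusSite)

namespace DownSandwich

/-- At `N = 0` the upper condensate vanishes, so the comparison `n₀⁺(λ,0) ≤ n₀⁺(0,0)` is trivial. [folklore] -/
theorem upperCondensate_le_of_card_eq_zero (v : ℝ → ℝ≥0∞) (L : ℝ) (M : ℕ) (w lam : ℝ) :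
    upperCondensate v 0 L M w lam 0 ≤ upperCondensate v 0 L M w 0 0 :=
  (MaxwellDanskin.upperCondensate_le_card v 0 L M w lam 0).trans (by simp)

/-- **DOWN, global, occupation form.** An upper-condensate floor above the well-volume share in the typed geometry
implies `DeepWallsDeplete` (deep LDM₀ for `n₀⁺`). [folklore] -/
theorem deepWallsDeplete_of_upperCondensateWellFloor
    (hfloor : ∀ v : ℝ → ℝ≥0∞, IsRepulsiveFiniteRange v → ∀ w : ℝ, 0 < w → w < 1 →
      ∃ b₁ : ℝ, 0 < b₁ ∧ ∃ ρ₁ : ℝ, 0 < ρ₁ ∧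
        ∀ M : ℕ, 2 ≤ M → ∀ L : ℝ, b₁ * M ≤ L → ∀ N : ℕ, (N : ℝ) ≤ ρ₁ * L ^ 3 → 1 ≤ N →
          ENNReal.ofReal ((1 - w) ^ 3 * N) < upperCondensate v N L M w 0 0) :
    DeepWallsDeplete := by
  intro v hv w hw0 hw1
  obtain ⟨hmeas, R₀, hR₀⟩ := hv
  obtain ⟨b₁, hb₁, ρ₁, hρ₁, hfl⟩ := hfloor v ⟨hmeas, R₀, hR₀⟩ w hw0 hw1
  set s : ℝ := max R₀ 1 with hs
  have hs0 : 0 < s := lt_of_lt_of_le one_pos (le_max_right _ _)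
  have h1w : 0 < 1 - w := by linarith
  refine ⟨max b₁ (8 * s / (1 - w)), lt_max_of_lt_left hb₁,
    min ρ₁ ((1 - w) ^ 3 / (64 * s ^ 3)), lt_min hρ₁ (by positivity), ?_⟩
  intro M hM L hL N hN
  have hM0 : 0 < M := by omega
  have hMR : (0 : ℝ) < M := by exact_mod_cast hM0
  have hLpos : 0 < L := lt_of_lt_of_le (by positivity) hL
  rcases Nat.eq_zero_or_pos N with hN0 | hNpos
  · subst hN0
    exact Eventually.of_forall fun lam => upperCondensate_le_of_card_eq_zero v L M w lam
  -- the floor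
  have hL₁ : b₁ * M ≤ L := le_trans (mul_le_mul_of_nonneg_right (le_max_left _ _) hMR.le) hL
  have hN₁ : (N : ℝ) ≤ ρ₁ * L ^ 3 := hN.trans (mul_le_mul_of_nonneg_right (min_le_left _ _) (by positivity))
  have hfloorN := hfl M hM L hL₁ N hN₁ hNpos
  -- the packing
  have hbig : 8 * max R₀ 1 / (1 - w) ≤ L / M := by
    rw [le_div_iff₀ hMR]
    show 8 * s / (1 - w) * M ≤ L
    exact le_trans (mul_le_mul_of_nonneg_right (le_max_right b₁ (8 * s / (1 - w))) hMR.le) hL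
  have hNd : (N : ℝ) ≤ (1 - w) ^ 3 / (64 * (max R₀ 1) ^ 3) * L ^ 3 :=
    hN.trans (mul_le_mul_of_nonneg_right (min_le_right _ _) (by positivity))
  obtain ⟨Φ, hΦw, hΦE⟩ := exists_state_in_wells_dilute (N := N) hmeas hR₀ hw0 hw1 hM0 hLpos hbig hNd
  exact deepWallsDeplete_at hM0 hLpos hw1.le v hΦw hΦE hfloorN

/-- **S1a in the few-body corner (certified).** For an admissible `v`, a wall fraction with `(1-w)³ < 2/3` (e.g. `w = ½`)
and a particle cap `N₀`, there is `B > 0` such that for every `M ≥ 1`, every torus with `L ≥ B·M` and every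
`2 ≤ N ≤ N₀`, the body of `DeepWallGerm` holds at `(v,N,L,M,w)` eventually in `λ`: few bosons on a large torus are
`2/3`-condensed (`CoarseCellLorentzian.FewBody.fewBody_condensed`), which is above the well-volume share, and the DOWN
theorem applies. So the open content of S1a is entirely the thermodynamic regime `N ≍ ρL³`. [folklore] -/
theorem deepWallGerm_fewBody (v : ℝ → ℝ≥0∞) (hv : IsRepulsiveFiniteRange v) {w : ℝ} (hw0 : 0 < w) (hw1 : w < 1)
    (hw23 : (1 - w) ^ 3 < 2 / 3) (N₀ : ℕ) :
    ∃ B : ℝ, 0 < B ∧ ∀ M : ℕ, 0 < M → ∀ L : ℝ, B * M ≤ L → ∀ n : ℕ, n + 2 ≤ N₀ →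
      ∀ᶠ lam : ℝ in atTop, ∀ ε : ℝ, 0 < ε → ∃ κ₀ : ℝ, 0 < κ₀ ∧
        ∀ kap : ℝ, 0 ≤ kap → kap ≤ κ₀ →
          twoCouplingEnergy v (n + 2) L M w lam 0 + twoCouplingEnergy v (n + 2) L M w 0 kap ≤
            twoCouplingEnergy v (n + 2) L M w lam kap + twoCouplingEnergy v (n + 2) L M w 0 0 +
              ENNReal.ofReal (ε * kap) := by
  obtain ⟨hmeas, R₀, hR₀⟩ := hv
  obtain ⟨L₂, hL₂, hfew⟩ := CoarseCellLorentzian.FewBody.fewBody_condensed v ⟨hmeas, R₀, hR₀⟩ N₀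
  set s : ℝ := max R₀ 1 with hs
  have hs0 : 0 < s := lt_of_lt_of_le one_pos (le_max_right _ _)
  have h1w : 0 < 1 - w := by linarith
  set B : ℝ := max L₂ (max (8 * s / (1 - w)) (4 * s * (N₀ + 1) / (1 - w))) with hB
  refine ⟨B, lt_max_of_lt_left hL₂, fun M hM L hL n hn => ?_⟩
  have hMR : (1 : ℝ) ≤ M := by exact_mod_cast hM
  have hM0 : (0 : ℝ) < M := by linarith
  have hBpos : 0 < B := lt_max_of_lt_left hL₂
  have hBL : B ≤ L := le_trans (le_mul_of_one_le_right hBpos.le hMR) hL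
  have hLpos : 0 < L := hBpos.trans_le hBL
  have hL₂L : L₂ ≤ L := (le_max_left _ _).trans hBL
  -- packing geometry
  have hbig : 8 * max R₀ 1 / (1 - w) ≤ L / M := by
    rw [le_div_iff₀ hM0]
    exact le_trans (mul_le_mul_of_nonneg_right ((le_max_left _ _).trans (le_max_right _ _)) hM0.le) hL
  have hL4 : 4 * s * (N₀ + 1) / (1 - w) ≤ L := ((le_max_right _ _).trans (le_max_right _ _)).trans hBL
  have hNd : (((n + 2 : ℕ) : ℝ)) ≤ (1 - w) ^ 3 / (64 * (max R₀ 1) ^ 3) * L ^ 3 := by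
    have hn' : ((n + 2 : ℕ) : ℝ) ≤ N₀ := by exact_mod_cast hn
    have hL4' : 4 * s * (N₀ + 1) ≤ (1 - w) * L := by
      rw [div_le_iff₀ h1w] at hL4; linarith
    have hN₀ : (N₀ : ℝ) ≤ ((N₀ : ℝ) + 1) ^ 3 := by
      have h0 : (0 : ℝ) ≤ N₀ := Nat.cast_nonneg _
      nlinarith [h0, sq_nonneg ((N₀ : ℝ) + 1)]
    calc ((n + 2 : ℕ) : ℝ) ≤ N₀ := hn'
      _ ≤ ((N₀ : ℝ) + 1) ^ 3 := hN₀
      _ = (4 * s * (N₀ + 1)) ^ 3 / (64 * s ^ 3) := by field_simp; ring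
      _ ≤ ((1 - w) * L) ^ 3 / (64 * s ^ 3) := by gcongr
      _ = (1 - w) ^ 3 / (64 * (max R₀ 1) ^ 3) * L ^ 3 := by rw [hs]; ring
  obtain ⟨Φ, hΦw, hΦE⟩ := exists_state_in_wells_dilute (N := n + 2) hmeas hR₀ hw0 hw1 hM hLpos hbig hNd
  -- the floor from few-body condensation
  have hE₀ : periodicGroundStateEnergy v (n + 2) L ≠ ⊤ :=
    ne_top_of_le_ne_top hΦE (iInf_le _ Φ)
  have hfloor : ENNReal.ofReal ((1 - w) ^ 3 * ((n + 2 : ℕ) : ℝ)) < upperCondensate v (n + 2) L M w 0 0 := by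
    have hlt : ENNReal.ofReal ((1 - w) ^ 3 * ((n + 2 : ℕ) : ℝ)) < ENNReal.ofReal (2 / 3 * ((n : ℝ) + 2)) := by
      rw [ENNReal.ofReal_lt_ofReal_iff (by positivity)]
      push_cast
      nlinarith
    refine hlt.trans_le ?_
    unfold upperCondensate
    refine le_iInf₂ fun δ hδ => ?_
    -- a `min δ (1/L³)`-near-minimiser exists and is `2/3`-condensed
    have hδ' : 0 < min δ (ENNReal.ofReal (1 / L ^ 3)) := lt_min hδ (ENNReal.ofReal_pos.2 (by positivity))
    obtain ⟨Ψ, hΨ⟩ := iInf_lt_iff.1 (ENNReal.lt_add_right hE₀ hδ'.ne')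
    have hΨδ : twoCouplingFunctional v M w 0 0 Ψ ≤ twoCouplingEnergy v (n + 2) L M w 0 0 + δ := by
      rw [twoCouplingFunctional_zero_zero, twoCouplingEnergy_zero_zero]
      exact hΨ.le.trans (add_le_add le_rfl (min_le_left _ _))
    have hΨL : periodicEnergy v Ψ ≤ periodicGroundStateEnergy v (n + 2) L + ENNReal.ofReal (1 / L ^ 3) :=
      hΨ.le.trans (add_le_add le_rfl (min_le_right _ _))
    exact le_iSup₂_of_le Ψ hΨδ (hfew L hL₂L n hn Ψ hΨL)
  exact deepWallGerm_at hM hLpos hw1.le v hΦw hΦE hfloor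


/-- **UP without the antecedent (the other side of the sandwich, constants explicit).** Deep LDM₀ for `n₀⁺`
(`DeepWallsDeplete`, the occupation form of S1a) and the deep-wall band (S2 `DeepWallBand`, reduced to S2′ by the landed
glue) give, in their joint typed geometry, the wall-free floor `z_w·cohSum(ψ)/M³ ≤ n₀⁺(0,0)` for every normalised
sector-`N` ground vector `ψ` of the hard-core hopping model — with the antecedent `A` at `(M,N)` this is `z_w c_A N ≤ n₀⁺(0,0)`
(the step `hU` of `LatticeToPeriodicBridge_of`). [folklore] -/
theorem upperCondensate_ge_deepShare (h1 : DeepWallsDeplete) (h2 : DeepWallBand) :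
    ∀ v : ℝ → ℝ≥0∞, IsRepulsiveFiniteRange v → ∀ w : ℝ, 0 < w → w < 1 →
      ∃ B : ℝ, 0 < B ∧ ∃ ρ₁ : ℝ, 0 < ρ₁ ∧
        ∀ (M : ℕ) [NeZero M], 2 ≤ M → ∀ L : ℝ, B * M ≤ L → ∀ N : ℕ, 1 ≤ N → N ≤ M ^ 3 →
          (N : ℝ) ≤ ρ₁ * L ^ 3 →
          ∀ ψ : TensorIndex (TorusSite 3 M) 2 → ℂ, IsSectorGround M N ψ →
            ENNReal.ofReal (deepShare w / (M : ℝ) ^ 3 * cohSum ψ N) ≤ upperCondensate v N L M w 0 0 := by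
  intro v hv w hw0 hw1
  obtain ⟨b₁, hb₁, ρ₁, hρ₁, hdep⟩ := h1 v hv w hw0 hw1
  obtain ⟨b₀, hb₀, hband⟩ := h2 v hv w hw0 hw1
  refine ⟨max b₀ b₁, lt_max_of_lt_left hb₀, ρ₁, hρ₁, ?_⟩
  intro M _ hM L hL N hN1 hNM hNρ ψ hψ
  have hM0 : (0 : ℝ) ≤ M := Nat.cast_nonneg _
  have hL₀ : b₀ * M ≤ L := le_trans (mul_le_mul_of_nonneg_right (le_max_left _ _) hM0) hL
  have hL₁ : b₁ * M ≤ L := le_trans (mul_le_mul_of_nonneg_right (le_max_right _ _) hM0) hL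
  calc ENNReal.ofReal (deepShare w / (M : ℝ) ^ 3 * cohSum ψ N)
      ≤ Filter.liminf (fun lam : ℝ => upperCondensate v N L M w lam 0) Filter.atTop := hband M hM L hL₀ N hN1 hNM ψ hψ
    _ ≤ upperCondensate v N L M w 0 0 := Filter.liminf_le_of_frequently_le' (hdep M hM L hL₁ N hNρ).frequently

end DownSandwich

/-- **Registered sub-goal `deepWallGerm_of_upperCondensateWellFloor` — DOWN half of the sandwich for the open stub
`stub_deepWallGerm`.** If, for every admissible `v` and wall fraction `w ∈ (0,1)`, the WALL-FREE upper condensate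
`n₀⁺(0,0)` exceeds the well-volume share `(1-w)³N` throughout a typed geometry `M ≥ 2`, `L ≥ b₁M`, `1 ≤ N ≤ ρ₁L³`, then
`Sig.stub_deepWallGerm` (= `DeepWallGerm`) holds: shrink the geometry to the dilute packing regime, take a finite-energy
state in the wells (`downSandwich_wellPacking`), apply the pointwise DOWN theorem (`downSandwich_deepWallGermAt`);
`N = 0` is trivial. [folklore] -/
theorem deepWallGerm_of_upperCondensateWellFloor
    (hfloor : ∀ v : ℝ → ENNReal, IsRepulsiveFiniteRange v → ∀ w : ℝ, 0 < w → w < 1 →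
      ∃ b₁ : ℝ, 0 < b₁ ∧ ∃ ρ₁ : ℝ, 0 < ρ₁ ∧
        ∀ M : ℕ, 2 ≤ M → ∀ L : ℝ, b₁ * M ≤ L → ∀ N : ℕ, (N : ℝ) ≤ ρ₁ * L ^ 3 → 1 ≤ N →
          ENNReal.ofReal ((1 - w) ^ 3 * N) < upperCondensate v N L M w 0 0) :
    Sig.stub_deepWallGerm := by
  intro v hv w hw0 hw1
  obtain ⟨b₁, hb₁, ρ₁, hρ₁, h⟩ := DownSandwich.deepWallsDeplete_of_upperCondensateWellFloor hfloor v hv w hw0 hw1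
  refine ⟨b₁, hb₁, ρ₁, hρ₁, fun M hM L hL N hN => ?_⟩
  filter_upwards [h M hM L hL N hN] with lam hlam
  exact fun ε hε => DownSandwich.germ_of_upperCondensate_le v N L M w lam hlam hε

end Summit.AtomisticToContinuum.BoseEinsteinCondensation.Cruxes.LatticeToPeriodicBridge.MuffinTinRewardSupermodularity

end
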